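import Summits.QuantumFields.YangMills.Theorems.BalabanUVNodesK0AxJoinTD9Cmp
import Summits.QuantumFields.YangMills.Theorems.BalabanUVNodesK0RecordFormatNamesDressedRows

/-!
# NODE O · K0ᴬ — ★★★ №541 (R-a) ASSEMBLED: [E] FROM (Tok-cmpU-cap) + ⁸'s MOULD AT THE LEG-DRESSED CHART `recordEmbJDressed φ′`, GIVEN `DressLink φ′` AND HypAn

LANDING NOTE (porter ▶ PTC-1 g4, 2026-08-31; AUTHORSHIP = ◇ lens-1 g10 «cauchy-analytic», HOME sketch `nodeO-cover/LENS-1g10-Rb-3-JoinTDressed-v2.lean` sha16 1c3761d6b08c96c5 · 80 l. · 1 thm · 0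
def · 0 sorry = v1 bb50d2c4c288ebfc with the `∃ C₉ δ₀` binder moved BEFORE `φ′ ∕ DressLink ∕ HypAn` (φ′-UNIFORM constants)): landed VERBATIM (only this paragraph added) under the basename ◇ lens-1
proposed, as PART B-3 of three (imports ✓`…K0AxJoinTD9Cmp` ✓p819078 + B-2 ✓`…K0RecordFormatNamesDressedRows`), on ★★★ director-ym №541 (R-a) ∕ №544 (c) and ◆ CRIT-1 g36's cuts: PART B
(B-1)(B-2)(B-3 v1) PASS ×3 — GO (nodeO STATUS 09:48:32Z) and ADDENDUM STAMP «(B-3) v2 PASS (supersedes v1 — land v2)», standing (Q-ord) check PASS and STRONGER than v1, J5′ 0 HIT, axioms standard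
on ◆'s concatenated run `LENS-1g10-Rb-scratchALL-v2.lean` fb6f6aafecfc4fb6 (nodeO STATUS 09:50:31Z); helper `--supports stmt-QuantumFields-27238 --as helper` (NO `--workitem`).  ◆'s RIDER
(09:48:32Z, said here as asked, one clause): at the junk value `φ′ ≡ 0` the displayed receipt `DressLink F θ k K 0` degenerates to `recordGkJ = recordGkLocWξ … univ`, i.e. the J5′-FORBIDDEN bridge
`recordD = recordHrLocξ univ` on the 𝐔-rows (the W-wrap tube, ✓`…K0AxCtabOptTube`) — there the hypothesis is suspect-UNSATISFIABLE and this implication harmless; the (C-orb) supplier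
`RootedResponseOrbitAt` (mod P0) must deliver the `φ′` whose gradient leg CARRIES the tube (block-constant comb potential), which is exactly why the bridge is legal only modulo an UNRESTRICTED
gradient.  HONEST (porter): calculus ∕ bookkeeping ∕ CONDITIONAL assembly over DISPLAYED rows (D1 = ⟨27930⟩'s ⁸ consequent, `DressLink` ⟸ (C-orb) `RootedResponseOrbitAt` mod P0, HypAn ∕ TokP9reg♭,
(Tok-cmpU-cap) — all OPEN, asserted nowhere); [E] inhabited unconditionally NOWHERE; nothing of Bałaban asserted, ported, discharged or refuted; K0ᴬ stmt-QuantumFields-27238 OPEN — NOTHING of it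
proved; NODE O 0∕1; COUNT 8∕28 · K 1∕4 UNMOVED; finite 𝕋⁴ at fixed ε — NOT continuum ∕ OS ∕ Clay; the Yang–Mills mass gap is NOT proved by any of this.

◇ `ymgap-nodeO-lens-1` g10 (planner; typed for the porter ▶ PTC-1 g4; lands AFTER `…K0AxJoinTD9Cmp` (v1.1 §4) and `…K0AxGaugeFlowRecDressed` + `…K0RecordFormatNamesDressedRows` (PART B-1∕B-2); target
`Summits/QuantumFields/YangMills/Theorems/BalabanUVNodesK0AxJoinTDressed.lean` `--supports stmt-QuantumFields-27238 --as helper`).  Items: K0ᴬ 27238 OPEN; K0⁷ 20541 OPEN.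

★★★ `twoVolExp_dressed_of_cmp` = ★★★`twoVolExp_LocUniv_of_cmp` (v1.1 §4) at the chart family `ιC k n := recordEmbJDressed F θ k (recordK₀ F Mc k + n) (φ′ k n)` (DEF-1 ed.20:
`recordEmbJ` composed with the gauge flow of the B-LINEAR dressing potential `recordDressPot φ′ B`), its three chart rows DISCHARGED by PART B: swap row ⟸
✓`eventually_recordChartJ_recordEmbJDressed` (continuity of `recordEmbJ` at 0), `C²` ⟸ ✓`contDiffAt_recordEmbJDressed` (HypAn), zero ⟸ ✓`recordEmbJDressed_zero_thetaFill` (DEF-1),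
LINK ⟸ ✓`recordGkLocWξ_univ_eq_fderiv_recordEmbJDressed` under the DISPLAYED receipt `DressLink F θ k K (φ′ k n)`.
WHAT STAYS DISPLAYED (all OPEN content, asserted nowhere): D1 (⁸'s `FormatPlusG` mould at `recordEmbJ` on `]0, γ₀]`-runs = ⟨27930⟩); `∀ k n, DressLink … (φ′ k n)` (rider (r1): `φ′` a
PARAMETER; supplier (C-orb) `RootedResponseOrbitAt` mod P0); HypAn `∀ k n, ContDiffAt ℝ 2 (recordEmbJ …) 0` ([14] (1.1)–(1.6), [15] (8)–(10)); (Tok-cmpU-cap) `TokCmpUCap F Mc a₀`;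
the catalogue guard `McGuard F Mc`, `Mc ≤ Mg`.  (Q-ord): the only existential `∃ C₉ δ₀` is bound right after the letters it depends on (`E₀ κ Mg c₁ F a₀ ε₂₉ γ₀ α₀ α₁ Mc`) and BEFORE `φ′`, `DressLink`, HypAn, D1 (φ′-UNIFORM constants, as in v1.1 §4).
RIDER (r2): no identity between the rooted tables `recordGkL ∕ recordHr ∕ recordD` and `recordGkLocWξ univ` is displayed or used (J5′-exempt).
HONEST: a CONDITIONAL theorem; [E] inhabited unconditionally NOWHERE; nothing of Bałaban ([I] Thm 1, (1.18)–(1.22), (4.35)–(4.37); [15] Prop. 9; [B6] (2.35)) asserted,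
ported or discharged; K0ᴬ 27238 ∕ K0⁷ 20541 OPEN; NODE O 0∕1; COUNT 8∕28 · K 1∕4 UNMOVED; finite `𝕋⁴_{L^K}` at fixed ε — NOT continuum ∕ OS ∕ Clay; **the Yang–Mills
mass gap is NOT proved.**  No `instance ∕ notation ∕ allowUnsafeReducibility`; 0 sorry; standard axioms.
-/

noncomputable section

open Filter Topology
open scoped BigOperators Matrix.Norms.L2Operator

namespace Summit.QuantumFields.YangMills.Theorems.K0AxJoinT

open Literature.MathematicalPhysics.QuantumFieldTheory.Balaban1983to89
open Literature.MathematicalPhysics.QuantumFieldTheory.Balaban1983to89.Node00 (betaOfRecord₁₃Ax Stage13Params)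
open Literature.MathematicalPhysics.QuantumFieldTheory.Balaban1983to89.T4Continuum (T4Family)
open Literature.MathematicalPhysics.QuantumFieldTheory.Balaban1983to89.B12FormatPlus
open Summit.QuantumFields.YangMills.Theorems.K0RecordFormatNames
open Summit.QuantumFields.YangMills.Theorems.K0AxTwoVolumeRate (RecordPvolTwoVolExpOnRunsAx)
open Literature.MathematicalPhysics.QuantumFieldTheory.Balaban1983to89.FlowStep
open Literature.MathematicalPhysics.QuantumFieldTheory.Balaban1983to89.FlowStepRuns

/-- ★★★ **`twoVolExp_dressed_of_cmp` — (R-a) «MOVE THE CHART, NOT THE LETTERS», ASSEMBLED.**  For `0 ≤ E₀`, `κ ≥ 4κ₀(64, 8)`, `0 < Mg`, `0 ≤ c₁`; every `F a₀ ε₂₉ γ₀ α₀ α₁`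
with `0 < a₀`, `0 < ε₂₉`, `0 < α₀`, `0 < α₁`; every admissible letter `McGuard F Mc` with `Mc ≤ Mg` and (Tok-cmpU-cap):
THERE ARE `C₉ ≥ 0`, `δ₀ > 0` (φ′-uniform) such that for every dressing-potential family `φ′` with the DISPLAYED receipt `DressLink … (φ′ k n)` and HypAn for `recordEmbJ`, D1 (⁸'s mould at `recordEmbJ` on `]0, γ₀]`-runs) gives [E]
`RecordPvolTwoVolExpOnRunsAx F a₀ ε₂₉ γ₀ E (δ₁∕16)` with the constants of ★★★`twoVolExp_LocUniv_of_cmp`.  CONDITIONAL; nothing of Bałaban asserted; `DressLink`, HypAn, D1,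
(Tok-cmpU-cap) OPEN; K0ᴬ OPEN; the Yang–Mills mass gap is NOT proved.
[cite: Balaban1987RG1, Thm 1 p.259, (1.7) p.261, (1.10) p.262, (1.18)–(1.22) pp.263–264, (4.8) p.283, (4.15) p.284, (4.35)–(4.37) pp.290–291, (5.10) p.293; Balaban1985Variational, Prop. 9 p.309; Balaban1984PropagatorsII, (2.35) p.228] -/
theorem twoVolExp_dressed_of_cmp {E₀ κ Mg c₁ : ℝ}
    (hE₀ : 0 ≤ E₀) (hκ : 4 * B12TreeDecay.kappa₀ (4 * 2 ^ 4) (2 * 4) ≤ κ) (hMg : 0 < Mg) (hc₁ : 0 ≤ c₁) :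
    ∀ (F : T4Family) (a₀ ε₂₉ γ₀ α₀ α₁ : ℝ), 0 < a₀ → 0 < ε₂₉ → 0 < α₀ → 0 < α₁ → ∀ Mc : ℕ, McGuard F Mc → (Mc : ℝ) ≤ Mg → TokCmpUCap F Mc a₀ →
      ∃ C₉ δ₀ : ℝ, 0 ≤ C₉ ∧ 0 < δ₀ ∧
      letI θ := thetaFill F a₀ ε₂₉; letI := θ.instVβ₁; letI := θ.instVβ₂; letI := θ.instιβ
      ∀ (φ' : (k n : ℕ) → RespLabel F k (recordK₀ F Mc k + n) → θ.ιβ → Site (F.P (recordK₀ F Mc k + n)) 0 → Fin 3 → ℂ),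
      (∀ k n : ℕ, DressLink F θ k (recordK₀ F Mc k + n) (φ' k n)) →
      (∀ k n : ℕ, ContDiffAt ℝ 2 (recordEmbJ F θ k (recordK₀ F Mc k + n)) 0) →
      ((∀ (k : ℕ) (g : ℕ → ℝ), FlowStep.RGEqH k (betaOfRecord₁₃Ax F 2 (thetaFill F a₀ ε₂₉)) g → Step.InInterval γ₀ k g →
        B12FormatPlus.FormatPlusG (fun n => recordDomSys F Mc k (recordK₀ F Mc k + n)) (fun n => recordBondCount F (recordK₀ F Mc k + n))
          (fun n => recordAct F (recordK₀ F Mc k + n)) (fun n => recordUc F Mc k α₀ α₁ (recordK₀ F Mc k + n))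
          (fun n => recordCoords F Mc k (recordK₀ F Mc k + n)) (fun n => recordChartDimJ F (recordK₀ F Mc k + n))
          (fun n => recordChartJ F Mc k (recordK₀ F Mc k + n)) (fun n => recordΦfAx F a₀ ε₂₉ k (FlowStep.prefixOf g k) (recordK₀ F Mc k + n))
          (fun n => recordEmbJ F θ k (recordK₀ F Mc k + n)) (fun n => recordWrapCtr F Mc k (recordK₀ F Mc k + n))
          (fun n => recordDomEmbCtr F Mc k (recordK₀ F Mc k + n)) (fun n _ => recordCoordProjCtr F (recordK₀ F Mc k + n)) E₀ κ) →
      RecordPvolTwoVolExpOnRunsAx F a₀ ε₂₉ γ₀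
        (48 * E₀ * C₉ ^ 2 * B12TreeDecay.K₀ (4 * 2 ^ 4) (2 * 4) * (2 * (1 - Real.exp (-(δ₀ / 4)))⁻¹) ^ 4 +
          32 * E₀ * C₉ ^ 2 * Real.exp (B12Decay510.delta1 δ₀ κ Mg * Mg * c₁) * B12TreeDecay.K₀ (4 * 2 ^ 4) (2 * 4) * (2 * (1 - Real.exp (-(δ₀ / 4)))⁻¹) ^ 4)
        (B12Decay510.delta1 δ₀ κ Mg * (1 / 16))) := by
  intro F a₀ ε₂₉ γ₀ α₀ α₁ ha₀ hε hα₀ hα₁ Mc hMc hMgMc hcmp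
  letI θ := thetaFill F a₀ ε₂₉; letI := θ.instVβ₁; letI := θ.instVβ₂; letI := θ.instιβ
  obtain ⟨C₉, δ₀, hC₉, hδ₀, h⟩ := twoVolExp_LocUniv_of_cmp hE₀ hκ hMg hc₁ F a₀ ε₂₉ γ₀ α₀ α₁ hε hα₀ hα₁ Mc hMc hMgMc hcmp
  have hz : ∀ k n : ℕ, (letI θ := thetaFill F a₀ ε₂₉; letI := θ.instVβ₁; letI := θ.instVβ₂;
      recordEmbJ F θ k (recordK₀ F Mc k + n) 0) = 0 := fun k n => PortU8.recordEmbJ_zero_thetaFill F a₀ ε₂₉ ha₀ Mc k n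
  refine ⟨C₉, δ₀, hC₉, hδ₀, fun φ' hDL hAn h8 => h (fun k n => recordEmbJDressed F (thetaFill F a₀ ε₂₉) k (recordK₀ F Mc k + n) (φ' k n)) h8 ?_ ?_⟩
  · intro k n
    exact eventually_recordChartJ_recordEmbJDressed F (thetaFill F a₀ ε₂₉) Mc k (recordK₀ F Mc k + n) (φ' k n) (hAn k n).continuousAt (hz k n)
  · intro k
    refine ⟨fun n => ⟨contDiffAt_recordEmbJDressed F (thetaFill F a₀ ε₂₉) k (recordK₀ F Mc k + n) (φ' k n) (hAn k n) (hz k n),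
      recordEmbJDressed_zero_thetaFill F a₀ ε₂₉ ha₀ Mc k n (φ' k n)⟩, fun n a l => ?_⟩
    exact recordGkLocWξ_univ_eq_fderiv_recordEmbJDressed F (thetaFill F a₀ ε₂₉) k (recordK₀ F Mc k + n) (φ' k n) (hDL k n) a l
      ((hAn k n).differentiableAt (by norm_num)) (hz k n)

end Summit.QuantumFields.YangMills.Theorems.K0AxJoinT

end
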